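import Literature.Probability.RandomPlanarGeometry.SLEBubblesVersionHolds
import Literature.Probability.RandomPlanarGeometry.RestrictionDerivOuter
import HarnessLib

/-!
# [LSW] p. 29: almost surely `cl Ξ(κ) ∩ (ℝ ∖ {0}) = ∅`, from the avoidance formula (7.3)

Proof-only file (no definition, no named fact), after

* G. F. Lawler, O. Schramm, W. Werner, *Conformal restriction: the chordal case*, J. Amer. Math.
  Soc. **16** (2003) 917–955, arXiv:math/0209343 (**[LSW]**, arXiv page numbers), proof of
  Thm. 7.3, p. 29: "Let `D := {z ∈ ℍ̄ : |z - x₀| ≤ ε}`, where `0 < ε < 1` and `x₀ ∈ [1, 2]`. Then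
  `1 - Φ'_D(0) = O(ε²)`. Consequently, `P[dist(Ξ, [1, 2]) < ε] = O(ε)`. Thus, a.s.,
  `cl Ξ ∩ [1, 2] = ∅`. By scaling, it follows that `cl Ξ ∩ (ℝ ∖ {0}) = ∅` a.s."

* `Literature.Probability.RandomPlanarGeometry.SLEBubbles.ae_closure_inter_range_ofReal_subset` —
  for `0 < κ ≤ 8/3`, a Brownian bubble measure `μ`, an independent Poisson cloud with mean
  `λ_κ μ ⊗ dt` and the avoidance formula (7.3) (the named fact `SLEBubbles.measure_disjoint`,
  hypothesis `h₂`), almost surely `cl Ξ(κ) ∩ ℝ ⊆ {0}`.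

Transcription of the printed proof: instead of `O(1/ε)` half-discs, for `0 < c ≤ R` ONE thin
`*`-hull `H₊ ⊇ {c/2 ≤ re ≤ R + c, 0 ≤ im ≤ θ}` with `Φ'_{H₊}(0) > 1 - ε` is used (a half-ellipse
hull of `EllipseHulls`, `SLEBubbles.exists_thin_hulls`, as in `RestrictionDerivOuter`), together
with its mirror image `σ(H₊)` for `[-R, -c]` (`exists_restrictionData_of_image`); (7.3) is applied
at every scale (no scaling invariance of `Ξ` is needed): a real point `x`, `c ≤ |x| ≤ R`, of
`cl Ξ` forces `Ξ ∩ (H₊ ∪ σ(H₊)) ≠ ∅`, an event of probability `≤ 2 (1 - (1 - ε)^{α_κ}) → 0`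
(the avoidance sets are null-measurable, `SLEBubbles.nullMeasurableSet_disjoint_holds`).

Used by `SLEBubblesClosedFillLaw` (the closed filling `F^ℝ_ℍ(cl(γ ∪ ⋃ X̂)) ∩ ℍ` is then in `Ω`).

Mathlib: `tendsto_one_div_add_atTop_nhds_zero_nat`, `Real.continuousAt_rpow_const`,
`ENNReal.Tendsto.sub`, `prob_compl_eq_one_sub₀`, `measure_eq_zero_iff_ae_notMem`.
-/

noncomputable section

open Set Filter Topology MeasureTheory Metric Bornology
open UpperHalfPlane (upperHalfPlaneSet isOpen_upperHalfPlaneSet)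
open scoped NNReal ENNReal
open Literature.Probability.Process (preWienerMeasure IsPoissonCloud)

namespace Literature.Probability.RandomPlanarGeometry

section RealLine

variable {κ : ℝ≥0} {μ : Measure BubbleConfig} {Ω' : Type} [MeasurableSpace Ω'] {P' : Measure Ω'}
  {X : Ω' → Set (BubbleConfig × ℝ≥0)}

/-- `8/3 ≤ 4` in `ℝ≥0`. [folklore] -/
theorem SLEBubbles.le_four_of_le {κ : ℝ≥0} (hκ : κ ≤ 8 / 3) : κ ≤ 4 :=
  hκ.trans (by
    rw [div_le_iff₀ (by norm_num : (0 : ℝ≥0) < 3)]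
    norm_num)

/-- The exponent `α_κ = (6 - κ)/(2κ)` is nonnegative for `κ ≤ 8/3`. [folklore] -/
theorem sleBubbleExponent_nonneg {κ : ℝ≥0} (hκ : κ ≤ 8 / 3) : 0 ≤ sleBubbleExponent κ := by
  have h4 : (κ : ℝ) ≤ 4 := by exact_mod_cast SLEBubbles.le_four_of_le hκ
  have h0 : (0 : ℝ) ≤ κ := κ.coe_nonneg
  unfold sleBubbleExponent
  exact div_nonneg (by linarith) (by positivity)

/-- Almost surely the trace of the first coordinate is a simple path (Rohde–Schramm, `κ ≤ 4`),
so that `γ(0, ∞) ∪ ⋃ X̂ ⊆ ℍ`. [cite: RohdeSchramm2005, Thm 6.1] -/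
theorem SLEBubbles.ae_isSimpleTrace_fst (hκ0 : 0 < κ) (hκ : κ ≤ 8 / 3) (P' : Measure Ω') :
    ∀ᵐ p ∂(preWienerMeasure.prod P'), Loewner.IsSimpleTrace (sleTrace κ p.1) :=
  (Measure.quasiMeasurePreserving_fst (μ := preWienerMeasure) (ν := P')).ae
    (SLEBubbles.ae_isSimpleTrace_sleTrace κ hκ0 (SLEBubbles.le_four_of_le hκ))

/-! ### [LSW] p. 29: almost surely `cl Ξ ∩ (ℝ ∖ {0}) = ∅`, from (7.3) -/

/-- **A thin `*`-hull over `[c, R]`, `0 < c`, of derivative close to `1`, and its mirror image**: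
for `ε > 0` there are `θ > 0` and `*`-hulls `H₊ ⊇ {c/2 ≤ re ≤ R + c, 0 ≤ im ≤ θ}`,
`H₋ = σ(H₊)` (`σ(z) = -z̄`), both with restriction derivative `> 1 - ε` (half-ellipse hulls,
`EllipseHulls`; `exists_rho_ellDeriv_gt`, `reProdIm_subset_ellHull`, `exists_restrictionData_of_image`).
[folklore] -/
theorem SLEBubbles.exists_thin_hulls {c R : ℝ} (hc : 0 < c) (hcR : c ≤ R) {ε : ℝ} (hε : 0 < ε) :
    ∃ (θ : ℝ) (H : Set ℂ), 0 < θ ∧ IsStarHull H ∧ IsStarHull (imagAxisRefl '' H) ∧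
      (∀ w : ℂ, c / 2 ≤ w.re → w.re ≤ R + c → 0 ≤ w.im → w.im ≤ θ → w ∈ H) ∧
      (∃ (Ψ : ConformalEquiv (upperHalfPlaneSet \ H) upperHalfPlaneSet) (e : ℝ),
        IsRestrictionMap H Ψ ∧ HasRestrictionDeriv H Ψ e ∧ 1 - ε < e) ∧
      (∃ (Ψ : ConformalEquiv (upperHalfPlaneSet \ (imagAxisRefl '' H)) upperHalfPlaneSet) (e : ℝ),
        IsRestrictionMap (imagAxisRefl '' H) Ψ ∧ HasRestrictionDeriv (imagAxisRefl '' H) Ψ e ∧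
          1 - ε < e) := by
  set a : ℝ := c / 2 with ha
  set b : ℝ := R + c with hb
  have ha0 : 0 < a := by positivity
  have hab : a < b := by rw [ha, hb]; linarith
  obtain ⟨ρ, hρ0, hρ1, hB, hder⟩ := exists_rho_ellDeriv_gt hab ha0 hε
  set θ : ℝ := ellH a b * (jLevel ρ - 2) / 2 with hθ
  have hθ0 : 0 < θ := by
    have h1 := ellH_pos hab
    have h2 := two_lt_jLevel hρ0 hρ1
    rw [hθ]
    exact div_pos (mul_pos h1 (by linarith)) two_pos
  have hθlt : θ < ellH a b * (jLevel ρ - 2) := by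
    have h1 := ellH_pos hab
    have h2 := two_lt_jLevel hρ0 hρ1
    have : 0 < ellH a b * (jLevel ρ - 2) := mul_pos h1 (by linarith)
    rw [hθ]
    linarith
  have hE : IsStarHull (ellHull a b ρ) := isStarHull_ellHull hab hρ0 hρ1 hB
  have hbox : ∀ w : ℂ, c / 2 ≤ w.re → w.re ≤ R + c → 0 ≤ w.im → w.im ≤ θ → w ∈ ellHull a b ρ :=
    fun w h1 h2 h3 h4 ↦ reProdIm_subset_ellHull hab le_rfl le_rfl hθlt ⟨⟨h1, h2⟩, ⟨h3, h4⟩⟩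
  have hmap := isRestrictionMap_ellConf hab hρ0 hρ1 hB
  have hdat := hasRestrictionDeriv_ellConf hab hρ0 hρ1 hB
  obtain ⟨Ψm, hΨm, hdm⟩ := exists_restrictionData_of_image rfl (ellConf hab hρ0 hρ1.le hB) hmap hdat
  exact ⟨θ, ellHull a b ρ, hθ0, hE, hE.image_imagAxisRefl, hbox, ⟨_, _, hmap, hdat, hder⟩,
    ⟨Ψm, _, hΨm, hdm, hder⟩⟩

/-- **[LSW] p. 29, "`cl Ξ ∩ (ℝ ∖ {0}) = ∅` a.s."**, from (7.3): for `0 < κ ≤ 8/3`, a Brownian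
bubble measure `μ` and an independent Poisson cloud with mean `λ_κ μ ⊗ dt`, almost surely the
closure of `Ξ(κ)` meets the real axis at most at `0`. Printed proof: "Let
`D := {z ∈ ℍ̄ : |z - x₀| ≤ ε}`, `x₀ ∈ [1, 2]`. Then `1 - Φ'_D(0) = O(ε²)`. Consequently,
`P[dist(Ξ, [1, 2]) < ε] = O(ε)`. Thus, a.s., `cl Ξ ∩ [1, 2] = ∅`. By scaling, it follows that
`cl Ξ ∩ (ℝ ∖ {0}) = ∅` a.s." Here, for every `0 < c < R`, a single thin `*`-hull `H₊` containing an
`ℍ̄`-neighbourhood of `[c, R]` with `Φ'_{H₊}(0) > 1 - ε` (and its mirror image for `[-R, -c]`) is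
used in place of the `O(1/ε)` half-discs, and (7.3) is applied at every scale instead of scaling:
`P[cl Ξ ∩ ±[c, R] ≠ ∅] ≤ 2 (1 - (1 - ε)^α) → 0`.
[cite: LawlerSchrammWerner2003Restriction, proof of Thm. 7.3 (p. 29)] -/
theorem SLEBubbles.ae_closure_inter_range_ofReal_subset (h₂ : SLEBubbles.measure_disjoint)
    (hκ0 : 0 < κ) (hκ : κ ≤ 8 / 3) (hμ : IsBrownianBubbleMeasure μ)
    (hX : IsPoissonCloud (bubbleCloudIntensity κ μ) X P') :
    ∀ᵐ p ∂(preWienerMeasure.prod P'),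
      closure (sleBubbleSet κ p.1 (X p.2)) ∩ range ((↑) : ℝ → ℂ) ⊆ {0} := by
  haveI : IsProbabilityMeasure preWienerMeasure := isProbabilityMeasure_preWienerMeasure'
  haveI : IsProbabilityMeasure P' := hX.isProbabilityMeasure
  set P : Measure ((ℝ≥0 → ℝ) × Ω') := preWienerMeasure.prod P' with hPdef
  set α : ℝ := sleBubbleExponent κ with hαdef
  have hα0 : 0 ≤ α := sleBubbleExponent_nonneg hκ
  -- the bad events, per pair of levels `0 < c ≤ R`
  set B : ℝ → ℝ → Set ((ℝ≥0 → ℝ) × Ω') := fun c R ↦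
    {p | ∃ x : ℝ, c ≤ |x| ∧ |x| ≤ R ∧ (x : ℂ) ∈ closure (sleBubbleSet κ p.1 (X p.2))} with hB
  have hB0 : ∀ c R : ℝ, 0 < c → c ≤ R → P (B c R) = 0 := by
    intro c R hc hcR
    -- `P (B c R) ≤ 2 (1 - (1 - ε)^α)` for `ε = 1/(n+1)`
    have hbound : ∀ n : ℕ, P (B c R) ≤
        2 * (1 - ENNReal.ofReal ((1 - 1 / ((n : ℝ) + 1)) ^ α)) := by
      intro n
      have hε : (0 : ℝ) < 1 / ((n : ℝ) + 1) := by positivity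
      have hε1 : 1 / ((n : ℝ) + 1) ≤ 1 := by
        rw [div_le_one (by positivity)]
        linarith
      obtain ⟨θ, H, hθ, hH, hHm, hbox, ⟨Ψ, e, hΨ, he, hεe⟩, ⟨Ψm, em, hΨm, hem, hεem⟩⟩ :=
        SLEBubbles.exists_thin_hulls hc hcR hε
      set Vp : Set ((ℝ≥0 → ℝ) × Ω') := {p | Disjoint (sleBubbleSet κ p.1 (X p.2)) H} with hVp
      set Vm : Set ((ℝ≥0 → ℝ) × Ω') :=
        {p | Disjoint (sleBubbleSet κ p.1 (X p.2)) (imagAxisRefl '' H)} with hVm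
      have hVpm : NullMeasurableSet Vp P := SLEBubbles.nullMeasurableSet_disjoint_holds hκ0 hκ hμ hX hH
      have hVmm : NullMeasurableSet Vm P := SLEBubbles.nullMeasurableSet_disjoint_holds hκ0 hκ hμ hX hHm
      have hPVp : P Vp = ENNReal.ofReal (e ^ α) := h₂ hκ0 hκ hμ hX hH hΨ he
      have hPVm : P Vm = ENNReal.ofReal (em ^ α) := h₂ hκ0 hκ hμ hX hHm hΨm hem
      -- `B ⊆ Vpᶜ ∪ Vmᶜ`
      have hsub : B c R ⊆ Vpᶜ ∪ Vmᶜ := by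
        rintro p ⟨x, hcx, hxR, hxcl⟩
        set Ξ : Set ℂ := sleBubbleSet κ p.1 (X p.2) with hΞ
        have hr : 0 < min θ (c / 2) := lt_min hθ (by positivity)
        obtain ⟨w, hw⟩ : (ball (x : ℂ) (min θ (c / 2)) ∩ Ξ).Nonempty :=
          mem_closure_iff_nhds.1 hxcl _ (ball_mem_nhds _ hr)
        have hwΞ : w ∈ Ξ := hw.2
        have hwim : 0 ≤ w.im := twoSidedFilling_subset _ hwΞ
        have hdist : dist w x < min θ (c / 2) := mem_ball.1 hw.1
        have hre : |w.re - x| < min θ (c / 2) := by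
          have h1 : |(w - x).re| ≤ ‖w - (x : ℂ)‖ := Complex.abs_re_le_norm _
          rw [← dist_eq_norm] at h1
          have h2 : (w - (x : ℂ)).re = w.re - x := by simp
          rw [h2] at h1
          exact h1.trans_lt hdist
        have him : w.im < min θ (c / 2) := by
          have h1 : |(w - x).im| ≤ ‖w - (x : ℂ)‖ := Complex.abs_im_le_norm _
          rw [← dist_eq_norm] at h1
          have h2 : (w - (x : ℂ)).im = w.im := by simp
          rw [h2] at h1
          exact (le_abs_self _).trans_lt (h1.trans_lt hdist)
        have hθ' : w.im ≤ θ := (him.trans_le (min_le_left _ _)).le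
        have hre' := (abs_lt.1 (hre.trans_le (min_le_right _ _)))
        rcases le_or_gt 0 x with hx0 | hx0
        · -- `x > 0`: `w ∈ H`
          rw [abs_of_nonneg hx0] at hcx hxR
          left
          intro hpV
          have hwH : w ∈ H := hbox w (by linarith [hre'.1]) (by linarith [hre'.2]) hwim hθ'
          exact Set.disjoint_left.1 hpV hwΞ hwH
        · -- `x < 0`: `σ w ∈ H`
          rw [abs_of_neg hx0] at hcx hxR
          right
          intro hpV
          have hwH : imagAxisRefl w ∈ H :=
            hbox (imagAxisRefl w) (by rw [imagAxisRefl_re]; linarith [hre'.2])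
              (by rw [imagAxisRefl_re]; linarith [hre'.1]) (by rw [imagAxisRefl_im]; exact hwim)
              (by rw [imagAxisRefl_im]; exact hθ')
          have hw' : w ∈ imagAxisRefl '' H := ⟨imagAxisRefl w, hwH, imagAxisRefl_imagAxisRefl w⟩
          exact Set.disjoint_left.1 hpV hwΞ hw'
      -- the bound
      have hone : ∀ {e' : ℝ}, 1 - 1 / ((n : ℝ) + 1) < e' →
          1 - ENNReal.ofReal (e' ^ α) ≤ 1 - ENNReal.ofReal ((1 - 1 / ((n : ℝ) + 1)) ^ α) := by
        intro e' he'
        refine tsub_le_tsub_left (ENNReal.ofReal_le_ofReal (Real.rpow_le_rpow ?_ he'.le hα0)) 1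
        linarith
      calc P (B c R) ≤ P (Vpᶜ ∪ Vmᶜ) := measure_mono hsub
        _ ≤ P Vpᶜ + P Vmᶜ := measure_union_le _ _
        _ = (1 - ENNReal.ofReal (e ^ α)) + (1 - ENNReal.ofReal (em ^ α)) := by
          rw [prob_compl_eq_one_sub₀ hVpm, prob_compl_eq_one_sub₀ hVmm, hPVp, hPVm]
        _ ≤ (1 - ENNReal.ofReal ((1 - 1 / ((n : ℝ) + 1)) ^ α)) +
              (1 - ENNReal.ofReal ((1 - 1 / ((n : ℝ) + 1)) ^ α)) := add_le_add (hone hεe) (hone hεem)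
        _ = 2 * (1 - ENNReal.ofReal ((1 - 1 / ((n : ℝ) + 1)) ^ α)) := by ring
    -- the bound tends to `0`
    have hlim : Tendsto (fun n : ℕ ↦ 2 * (1 - ENNReal.ofReal ((1 - 1 / ((n : ℝ) + 1)) ^ α))) atTop
        (𝓝 0) := by
      have h1 : Tendsto (fun n : ℕ ↦ (1 - 1 / ((n : ℝ) + 1))) atTop (𝓝 1) := by
        have := (tendsto_one_div_add_atTop_nhds_zero_nat (𝕜 := ℝ)).const_sub 1
        simpa using this
      have h2 : Tendsto (fun x : ℝ ↦ x ^ α) (𝓝 1) (𝓝 (1 ^ α)) :=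
        (Real.continuousAt_rpow_const 1 α (Or.inl one_ne_zero)).tendsto
      rw [Real.one_rpow] at h2
      have h3 : Tendsto (fun n : ℕ ↦ ENNReal.ofReal ((1 - 1 / ((n : ℝ) + 1)) ^ α)) atTop (𝓝 1) := by
        have := (ENNReal.continuous_ofReal.tendsto _).comp (h2.comp h1)
        simpa [Function.comp_def] using this
      have h4 : Tendsto (fun n : ℕ ↦ 1 - ENNReal.ofReal ((1 - 1 / ((n : ℝ) + 1)) ^ α)) atTop
          (𝓝 (1 - 1)) := ENNReal.Tendsto.sub tendsto_const_nhds h3 (Or.inl ENNReal.one_ne_top)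
      have h5 := ENNReal.Tendsto.const_mul h4 (Or.inr (by norm_num : (2 : ℝ≥0∞) ≠ ∞))
      simpa using h5
    exact le_antisymm (ge_of_tendsto' hlim hbound) zero_le
  -- almost surely no bad event for rational levels
  have hae : ∀ᵐ p ∂P, ∀ q : ℚ × ℚ, 0 < (q.1 : ℝ) → (q.1 : ℝ) ≤ q.2 → p ∉ B q.1 q.2 := by
    refine ae_all_iff.2 fun q ↦ ?_
    by_cases hq : 0 < (q.1 : ℝ) ∧ (q.1 : ℝ) ≤ q.2
    · filter_upwards [measure_eq_zero_iff_ae_notMem.1 (hB0 q.1 q.2 hq.1 hq.2)] with p hp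
      exact fun _ _ ↦ hp
    · exact ae_of_all _ fun p h1 h2 ↦ absurd ⟨h1, h2⟩ hq
  filter_upwards [hae] with p hp
  rintro z ⟨hzcl, x, rfl⟩
  rw [mem_singleton_iff]
  by_contra hx0
  have hx : x ≠ 0 := fun h ↦ hx0 (by rw [h, Complex.ofReal_zero])
  have hxpos : 0 < |x| := abs_pos.2 hx
  obtain ⟨c, hc0, hcx⟩ := exists_rat_btwn hxpos
  obtain ⟨R, hxR⟩ := exists_rat_gt |x|
  exact hp ⟨c, R⟩ hc0 (hcx.le.trans hxR.le) ⟨x, hcx.le, hxR.le, hzcl⟩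

end RealLine

end Literature.Probability.RandomPlanarGeometry

end
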